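import Mathlib.RingTheory.Valuation.Discrete.IsDiscreteValuationRing
import Mathlib.Data.ZMod.QuotientRing
import Literature.NumberTheory.DiophantineGeometry.MinimalDiscriminant
import HarnessLib

/-!
# The minimal discriminant of a Weierstrass curve — the `𝓞 ℚ` versus `ℤ` bridge (proofs)

Sibling proof file of `Literature.NumberTheory.DiophantineGeometry.MinimalDiscriminant` (D-0014:
named facts stay `def … : Prop`; their discharges `theorem <fact>_holds : <fact>` live in
sorry-free sibling files, one per fact so that concurrent discharges do not overwrite each other).
This file discharges

* `WeierstrassCurve.minimalDiscriminantNorm_ringOfIntegers_rat` by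
  `WeierstrassCurve.minimalDiscriminantNorm_ringOfIntegers_rat_holds`,

and proves on the way the `R`-independent prime factorisation
`WeierstrassCurve.minimalDiscriminantNorm_eq_finprod_primes` and the `p`-adic description
`WeierstrassCurve.ordMinimalDiscriminant_eq_padic` of `ord_v (Δ_min)`, valid for every integer
ring `R` of `ℚ`.

## References

* J. H. Silverman, *The Arithmetic of Elliptic Curves*, GTM 106, 2nd ed. 2009, §VII.1 (Definition of
  the valuation of the minimal discriminant, Prop. 1.3(b)), §VIII.8 (Definition of `𝒟_{E/K}`).
-/

/-! ## Discharge of `WeierstrassCurve.minimalDiscriminantNorm_ringOfIntegers_rat`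

The bridge `W.minimalDiscriminantNorm (𝓞 ℚ) = W.minimalDiscriminantNorm ℤ` is folklore; the proof
below is a transport argument that never compares `𝓞 ℚ` and `ℤ` directly. For *any* integer ring
`R` of `ℚ` (`[IsIntegralClosure R ℤ ℚ]`, so `R = ℤ` or `R = 𝓞 ℚ`) we show

  `W.minimalDiscriminantNorm R = ∏ᶠ p : Nat.Primes, p ^ e_p (W)`,
  `e_p (W) := (addVal ℤ_[p] (((W.baseChange ℚ_[p]).minimal ℤ_[p]).integralModel ℤ_[p]).Δ).toNat`

(`WeierstrassCurve.minimalDiscriminantNorm_eq_finprod_primes`), whose right-hand side does not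
mention `R`. The steps:

* (transport, `WeierstrassCurve.addVal_Δ_minimal_ringEquiv`) for two DVR / fraction-field pairs
  `R₁ ⊆ K₁`, `R₂ ⊆ K₂` and compatible ring isomorphisms `ψ : R₁ ≃+* R₂`, `φ : K₁ ≃+* K₂`,
  integrality and minimality of Weierstrass equations (Mathlib's `WeierstrassCurve.IsIntegral`,
  `WeierstrassCurve.IsMinimal`) are transported along `φ`, any two minimal equations of the same
  curve have the same `v (Δ)` (Silverman, AEC VII.1, the definition of the *valuation of the minimal
  discriminant* preceding Remark 1.1, and Prop. 1.3(b)), and `v (Δ)` of an integral equation is read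
  off from `addVal` of its integral model (`IsDiscreteValuationRing.intValuation_maximalIdeal`);
* (local, `WeierstrassCurve.ordMinimalDiscriminant_eq_padic`) specialise to Mathlib's
  `Rat.HeightOneSpectrum.adicCompletion.padicEquiv v : v.adicCompletion ℚ ≃A[ℚ] ℚ_[p]` and
  `adicCompletionIntegers.padicIntEquiv v : v.adicCompletionIntegers ℚ ≃A[ℤ] ℤ_[p]`
  (`p = Rat.HeightOneSpectrum.primesEquiv v`), giving `W.ordMinimalDiscriminant v = e_p (W)`;
* (global) `Ideal.absNorm` is multiplicative with `absNorm I = 1 ↔ I = ⊤`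
  (`MonoidHom.map_finprod_of_preimage_one`, no finiteness needed), `absNorm v.asIdeal = p`
  (`Literature.NumberTheory.DiophantineGeometry.MinimalDiscriminant.absNorm_asIdeal_eq_natGenerator`, via `R ⧸ v ≃+* ℤ ⧸ p ≃+* ZMod p`),
  and the product is reindexed along `primesEquiv : HeightOneSpectrum R ≃ Nat.Primes`.

`ℤ_[p]`, `ℚ_[p]` for `p : Nat.Primes` need `Fact p.1.Prime`; as in
`Mathlib.NumberTheory.Padics.HeightOneSpectrum` this is supplied locally, here by an inline
`haveI : Fact p.1.Prime := ⟨p.2⟩` in the two statements mentioning `Nat.Primes` (no instance is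
declared).
-/

namespace Literature.NumberTheory.DiophantineGeometry.MinimalDiscriminant

open IsDedekindDomain IsDiscreteValuationRing
open scoped WithZero

section RingEquiv

variable {R₁ K₁ R₂ K₂ : Type*}
  [CommRing R₁] [Field K₁] [Algebra R₁ K₁] [CommRing R₂] [Field K₂] [Algebra R₂ K₂]
  (ψ : R₁ ≃+* R₂) (φ : K₁ ≃+* K₂)
  (hc : ∀ r : R₁, φ (algebraMap R₁ K₁ r) = algebraMap R₂ K₂ (ψ r))

include hc in
/-- If `φ ∘ algebraMap = algebraMap ∘ ψ` for ring isomorphisms `ψ : R₁ ≃+* R₂`, `φ : K₁ ≃+* K₂`,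
then the same compatibility holds for the inverses. [folklore] -/
theorem ringEquiv_compat_symm (r : R₂) :
    φ.symm (algebraMap R₂ K₂ r) = algebraMap R₁ K₁ (ψ.symm r) := by
  apply φ.injective
  rw [RingEquiv.apply_symm_apply, hc, RingEquiv.apply_symm_apply]

end RingEquiv

section DVR

variable {R₁ K₁ R₂ K₂ : Type*}
  [CommRing R₁] [IsDomain R₁] [IsDiscreteValuationRing R₁] [Field K₁] [Algebra R₁ K₁]
  [IsFractionRing R₁ K₁]
  [CommRing R₂] [IsDomain R₂] [IsDiscreteValuationRing R₂] [Field K₂] [Algebra R₂ K₂]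
  [IsFractionRing R₂ K₂]

omit [IsFractionRing R₁ K₁] [IsDomain R₁] [IsDiscreteValuationRing R₁] [Algebra R₁ K₁] [Field K₁]
  [CommRing R₁] in
/-- The map `ℕ∞ → ℤᵐ⁰`, `n ↦ exp (-n)`, `⊤ ↦ 0` appearing in
`IsDiscreteValuationRing.intValuation_maximalIdeal` is injective. [folklore] -/
theorem eq_of_recTopCoe_inv_eq {a b : ℕ∞}
    (hab : (ENat.recTopCoe 0
        (fun n : ℕ ↦ ((Multiplicative.ofAdd (n : ℤ) : Multiplicative ℤ) : ℤᵐ⁰)) a : ℤᵐ⁰)⁻¹ =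
      (ENat.recTopCoe 0
        (fun n : ℕ ↦ ((Multiplicative.ofAdd (n : ℤ) : Multiplicative ℤ) : ℤᵐ⁰)) b : ℤᵐ⁰)⁻¹) :
    a = b := by
  rw [inv_inj] at hab
  induction a using ENat.recTopCoe <;> induction b using ENat.recTopCoe <;>
    simp_all

variable (ψ : R₁ ≃+* R₂) (φ : K₁ ≃+* K₂)
  (hc : ∀ r : R₁, φ (algebraMap R₁ K₁ r) = algebraMap R₂ K₂ (ψ r))

/-- The additive valuation of a discrete valuation ring is invariant under ring isomorphisms
(a ring isomorphism maps a uniformiser to a uniformiser and units to units). [folklore] -/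
theorem addVal_ringEquiv (a : R₁) : addVal R₂ (ψ a) = addVal R₁ a := by
  rcases eq_or_ne a 0 with rfl | ha
  · simp
  obtain ⟨ϖ, hϖ⟩ := IsDiscreteValuationRing.exists_irreducible R₁
  obtain ⟨n, u, rfl⟩ := IsDiscreteValuationRing.eq_unit_mul_pow_irreducible ha hϖ
  have h : ψ (u * ϖ ^ n) = (Units.map ψ.toMonoidHom u : R₂) * ψ ϖ ^ n := by simp
  rw [addVal_def' u hϖ n, h, addVal_def' _ ((MulEquiv.irreducible_iff ψ).mpr hϖ) n]

include hc in
/-- The `𝔪`-adic valuation on the fraction field of a discrete valuation ring is invariant under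
compatible ring isomorphisms `(R₁ ⊆ K₁) ≃ (R₂ ⊆ K₂)`. [folklore] -/
theorem valuation_maximalIdeal_ringEquiv (x : K₁) :
    HeightOneSpectrum.valuation K₂ (maximalIdeal R₂) (φ x) =
      HeightOneSpectrum.valuation K₁ (maximalIdeal R₁) x := by
  obtain ⟨a, b, hb, rfl⟩ := IsFractionRing.div_surjective (A := R₁) x
  rw [map_div₀, hc, hc, map_div₀, map_div₀, HeightOneSpectrum.valuation_of_algebraMap,
    HeightOneSpectrum.valuation_of_algebraMap, HeightOneSpectrum.valuation_of_algebraMap,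
    HeightOneSpectrum.valuation_of_algebraMap, intValuation_maximalIdeal,
    intValuation_maximalIdeal, intValuation_maximalIdeal, intValuation_maximalIdeal,
    addVal_ringEquiv, addVal_ringEquiv]

end DVR

section Rat

open Rat.HeightOneSpectrum

variable {R : Type*} [CommRing R] [IsDedekindDomain R] [Algebra R ℚ] [IsIntegralClosure R ℤ ℚ]
  [Module.Free ℤ R]

/-- For an integer ring `R` of `ℚ` (`R ≃+* ℤ` via `Rat.IsIntegralClosure.intEquiv`), the residue
ring at a height-one prime `v` has `p = Rat.HeightOneSpectrum.natGenerator v` elements: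
`Ideal.absNorm v.asIdeal = p` (via `R ⧸ v ≃+* ℤ ⧸ (p) ≃+* ZMod p`). [folklore] -/
theorem absNorm_asIdeal_eq_natGenerator (v : HeightOneSpectrum R) :
    Ideal.absNorm v.asIdeal = natGenerator v := by
  rw [Ideal.absNorm_apply, Submodule.cardQuot_apply]
  have e : R ⧸ v.asIdeal ≃+* ℤ ⧸ Ideal.span {(natGenerator v : ℤ)} :=
    Ideal.quotientEquiv _ _ (Rat.IsIntegralClosure.intEquiv R) (span_natGenerator v)
  rw [Nat.card_congr (e.trans (Int.quotientSpanNatEquivZMod _)).toEquiv, Nat.card_zmod]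

end Rat

end Literature.NumberTheory.DiophantineGeometry.MinimalDiscriminant

namespace WeierstrassCurve

open IsDedekindDomain IsDiscreteValuationRing Literature.NumberTheory.DiophantineGeometry.MinimalDiscriminant
open scoped WithZero

section TransportIntegral

variable {R₁ K₁ R₂ K₂ : Type*}
  [CommRing R₁] [Field K₁] [Algebra R₁ K₁] [CommRing R₂] [Field K₂] [Algebra R₂ K₂]
  (ψ : R₁ ≃+* R₂) (φ : K₁ ≃+* K₂)
  (hc : ∀ r : R₁, φ (algebraMap R₁ K₁ r) = algebraMap R₂ K₂ (ψ r))

include hc in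
/-- Integrality of a Weierstrass equation (Mathlib's `WeierstrassCurve.IsIntegral`) is transported
along compatible ring isomorphisms `(R₁ ⊆ K₁) ≃ (R₂ ⊆ K₂)`. [folklore] -/
theorem isIntegral_map_ringEquiv {X : WeierstrassCurve K₁} (h : IsIntegral R₁ X) :
    IsIntegral R₂ (X.map (φ : K₁ →+* K₂)) := by
  obtain ⟨X₀, rfl⟩ := h.integral
  refine ⟨X₀.map (ψ : R₁ →+* R₂), ?_⟩
  simp only [baseChange, map_map]
  congr 1
  ext r
  exact hc r

include hc in
/-- `WeierstrassCurve.isIntegral_map_ringEquiv` as an `iff`. [folklore] -/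
theorem isIntegral_map_ringEquiv_iff (X : WeierstrassCurve K₁) :
    IsIntegral R₂ (X.map (φ : K₁ →+* K₂)) ↔ IsIntegral R₁ X := by
  refine ⟨fun h ↦ ?_, isIntegral_map_ringEquiv ψ φ hc⟩
  have := isIntegral_map_ringEquiv ψ.symm φ.symm (ringEquiv_compat_symm ψ φ hc) h
  simpa [map_map] using this

end TransportIntegral

section Transport

variable {R₁ K₁ R₂ K₂ : Type*}
  [CommRing R₁] [IsDomain R₁] [IsDiscreteValuationRing R₁] [Field K₁] [Algebra R₁ K₁]
  [IsFractionRing R₁ K₁]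
  [CommRing R₂] [IsDomain R₂] [IsDiscreteValuationRing R₂] [Field K₂] [Algebra R₂ K₂]
  [IsFractionRing R₂ K₂]

/-- Two minimal Weierstrass equations (Mathlib's `WeierstrassCurve.IsMinimal`) in the same
`K`-isomorphism class have the same discriminant valuation: the *valuation of the minimal
discriminant* is well defined. Silverman, AEC VII.1, Definition preceding Remark 1.1 and
Prop. 1.3(b). [cite: SilvermanAEC2009, VII.1 Prop. 1.3(b)] -/
theorem valuation_Δ_aux_eq_of_isMinimal {Y Y' : WeierstrassCurve K₁} (hY : IsMinimal R₁ Y)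
    (hY' : IsMinimal R₁ Y') (C : VariableChange K₁) (h : Y' = C • Y) :
    valuation_Δ_aux R₁ Y' = valuation_Δ_aux R₁ Y := by
  subst h
  have h1 := hY.val_Δ_maximal
  have h2 := hY'.val_Δ_maximal
  rcases le_total (valuation_Δ_aux R₁ Y) (valuation_Δ_aux R₁ (C • Y)) with h | h
  · refine le_antisymm ?_ h
    have := h1.2 (j := C) (by simpa using h2.1) (by simpa using h)
    simpa using this
  · refine le_antisymm h ?_
    have := h2.2 (j := C⁻¹) (by simpa [smul_smul] using h1.1) (by simpa [smul_smul] using h)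
    simpa [smul_smul] using this

/-- For an integral Weierstrass equation `Y` over the fraction field of a DVR `R₁`, the `𝔪`-adic
valuation of `Δ (Y)` is `exp (-(addVal R₁ (Δ (Y.integralModel R₁))))`
(`IsDiscreteValuationRing.intValuation_maximalIdeal`). [folklore] -/
theorem valuation_Δ_eq_addVal (Y : WeierstrassCurve K₁) [IsIntegral R₁ Y] :
    HeightOneSpectrum.valuation K₁ (maximalIdeal R₁) Y.Δ =
      (ENat.recTopCoe 0 (fun n : ℕ ↦ ((Multiplicative.ofAdd (n : ℤ) : Multiplicative ℤ) : ℤᵐ⁰))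
        (addVal R₁ (Y.integralModel R₁).Δ))⁻¹ := by
  rw [← integralModel_Δ_eq R₁ Y, HeightOneSpectrum.valuation_of_algebraMap,
    intValuation_maximalIdeal]

variable (ψ : R₁ ≃+* R₂) (φ : K₁ ≃+* K₂)
  (hc : ∀ r : R₁, φ (algebraMap R₁ K₁ r) = algebraMap R₂ K₂ (ψ r))

include ψ hc in
/-- The (truncated) discriminant valuation `WeierstrassCurve.valuation_Δ_aux` is invariant under
compatible ring isomorphisms `(R₁ ⊆ K₁) ≃ (R₂ ⊆ K₂)`. [folklore] -/
theorem valuation_Δ_aux_map_ringEquiv (X : WeierstrassCurve K₁) :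
    (valuation_Δ_aux R₂ (X.map (φ : K₁ →+* K₂)) : ℤᵐ⁰) = valuation_Δ_aux R₁ X := by
  by_cases h : IsIntegral R₁ X
  · haveI := isIntegral_map_ringEquiv ψ φ hc h
    rw [valuation_Δ_aux_eq_of_isIntegral, valuation_Δ_aux_eq_of_isIntegral, map_Δ,
      RingEquiv.coe_toRingHom, valuation_maximalIdeal_ringEquiv ψ φ hc]
  · have h' : ¬ IsIntegral R₂ (X.map (φ : K₁ →+* K₂)) :=
      fun h' ↦ h ((isIntegral_map_ringEquiv_iff ψ φ hc X).mp h')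
    simp [valuation_Δ_aux, h, h']

include ψ hc in
/-- Comparison of discriminant valuations is invariant under compatible ring isomorphisms
`(R₁ ⊆ K₁) ≃ (R₂ ⊆ K₂)`. [folklore] -/
theorem valuation_Δ_aux_map_le_iff (X Y : WeierstrassCurve K₁) :
    valuation_Δ_aux R₂ (Y.map (φ : K₁ →+* K₂)) ≤ valuation_Δ_aux R₂ (X.map (φ : K₁ →+* K₂)) ↔
      valuation_Δ_aux R₁ Y ≤ valuation_Δ_aux R₁ X := by
  rw [← Subtype.coe_le_coe, ← Subtype.coe_le_coe, valuation_Δ_aux_map_ringEquiv ψ φ hc,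
    valuation_Δ_aux_map_ringEquiv ψ φ hc]

include ψ hc in
/-- Minimality of a Weierstrass equation (Mathlib's `WeierstrassCurve.IsMinimal`) is transported
along compatible ring isomorphisms `(R₁ ⊆ K₁) ≃ (R₂ ⊆ K₂)` (changes of variables over `K₂` are the
images of changes of variables over `K₁`). [folklore] -/
theorem isMinimal_map_ringEquiv (X : WeierstrassCurve K₁) [hX : IsMinimal R₁ X] :
    IsMinimal R₂ (X.map (φ : K₁ →+* K₂)) := by
  refine ⟨⟨by simpa using isIntegral_map_ringEquiv ψ φ hc (inferInstance : IsIntegral R₁ X),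
    fun C hC hle ↦ ?_⟩⟩
  dsimp only at hC hle ⊢
  set C₁ : VariableChange K₁ := C.map (φ.symm : K₂ →+* K₁) with hC₁
  have hCC : C = C₁.map (φ : K₁ →+* K₂) := by
    rw [hC₁, VariableChange.map_map]
    ext <;> simp
  rw [hCC, map_variableChange] at hC hle ⊢
  rw [one_smul] at hle ⊢
  rw [isIntegral_map_ringEquiv_iff ψ φ hc] at hC
  have h1 := hX.val_Δ_maximal.2 (j := C₁) (by simpa using hC)
  simp only [one_smul] at h1
  rw [valuation_Δ_aux_map_le_iff ψ φ hc]
  exact h1 ((valuation_Δ_aux_map_le_iff ψ φ hc _ _).mp hle)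

include ψ hc in
/-- **Transport of `ord (Δ_min)`.** For compatible ring isomorphisms `(R₁ ⊆ K₁) ≃ (R₂ ⊆ K₂)` of
DVR / fraction-field pairs and `X : WeierstrassCurve K₁`, the additive valuation of the
discriminant of the integral model of Mathlib's chosen minimal equation `X.minimal R₁` equals the
one of `(X.map φ).minimal R₂` (the two chosen minimal equations need not correspond under `φ`, but
their discriminant valuations agree by `valuation_Δ_aux_eq_of_isMinimal`).
Silverman, AEC VII.1, Prop. 1.3(b). [cite: SilvermanAEC2009, VII.1 Prop. 1.3(b)] -/
theorem addVal_Δ_minimal_ringEquiv (X : WeierstrassCurve K₁) :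
    addVal R₂ ((((X.map (φ : K₁ →+* K₂)).minimal R₂).integralModel R₂).Δ) =
      addVal R₁ (((X.minimal R₁).integralModel R₁).Δ) := by
  -- the two minimal models over `K₂`
  set C₁ := (X.exists_isMinimal R₁).choose
  set C₂ := ((X.map (φ : K₁ →+* K₂)).exists_isMinimal R₂).choose
  have hM₁ : X.minimal R₁ = C₁ • X := rfl
  have hM₂ : (X.map (φ : K₁ →+* K₂)).minimal R₂ = C₂ • X.map (φ : K₁ →+* K₂) := rfl
  have hmin₁ : IsMinimal R₂ ((X.minimal R₁).map (φ : K₁ →+* K₂)) :=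
    isMinimal_map_ringEquiv ψ φ hc _
  have hmin₂ : IsMinimal R₂ ((X.map (φ : K₁ →+* K₂)).minimal R₂) := inferInstance
  have hrel : (X.map (φ : K₁ →+* K₂)).minimal R₂ =
      (C₂ * (C₁.map (φ : K₁ →+* K₂))⁻¹) • (X.minimal R₁).map (φ : K₁ →+* K₂) := by
    rw [hM₂, hM₁, ← map_variableChange, smul_smul, inv_mul_cancel_right]
  have hval := congrArg Subtype.val (valuation_Δ_aux_eq_of_isMinimal hmin₁ hmin₂ _ hrel)
  rw [valuation_Δ_aux_map_ringEquiv ψ φ hc,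
    valuation_Δ_aux_eq_of_isIntegral, valuation_Δ_aux_eq_of_isIntegral,
    valuation_Δ_eq_addVal, valuation_Δ_eq_addVal] at hval
  exact eq_of_recTopCoe_inv_eq hval

include ψ hc in
/-- `WeierstrassCurve.addVal_Δ_minimal_ringEquiv` with the target curve abstracted (avoids
rewriting under the `IsIntegral` instance argument of `integralModel`). [folklore] -/
theorem addVal_Δ_minimal_ringEquiv' (X : WeierstrassCurve K₁) {Y : WeierstrassCurve K₂}
    (hY : X.map (φ : K₁ →+* K₂) = Y) :
    addVal R₂ (((Y.minimal R₂).integralModel R₂).Δ) =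
      addVal R₁ (((X.minimal R₁).integralModel R₁).Δ) := by
  subst hY
  exact addVal_Δ_minimal_ringEquiv ψ φ hc X

end Transport

section Padic

open Rat.HeightOneSpectrum

variable {R : Type*} [CommRing R] [IsDedekindDomain R] [Algebra R ℚ] [IsFractionRing R ℚ]
  [IsIntegralClosure R ℤ ℚ]

/-- `ord_v (Δ_min)` computed in Mathlib's `p`-adic numbers: for `v : HeightOneSpectrum R` above
the prime `p = primesEquiv v`, transport along `v.adicCompletion ℚ ≃A[ℚ] ℚ_[p]` and
`v.adicCompletionIntegers ℚ ≃A[ℤ] ℤ_[p]` (`Rat.HeightOneSpectrum.adicCompletion.padicEquiv`,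
`Rat.HeightOneSpectrum.adicCompletionIntegers.padicIntEquiv`); the base changes of `W` correspond
because `ℚ →+* ℚ_[p]` is unique. (`Fact p.Prime` is supplied inline, see the section docstring.)
[folklore] -/
theorem ordMinimalDiscriminant_eq_padic (v : HeightOneSpectrum R) (W : WeierstrassCurve ℚ) :
    haveI : Fact (primesEquiv v).1.Prime := ⟨(primesEquiv v).2⟩
    W.ordMinimalDiscriminant v =
      (addVal ℤ_[primesEquiv v] (((W.baseChange ℚ_[primesEquiv v]).minimal
        ℤ_[primesEquiv v]).integralModel ℤ_[primesEquiv v]).Δ).toNat := by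
  have _inst (p : Nat.Primes) : Fact p.1.Prime := ⟨p.2⟩
  unfold ordMinimalDiscriminant localMinimalIntegralModel localMinimalModel
  congr 1
  have hc : ∀ r : v.adicCompletionIntegers ℚ,
      (adicCompletion.padicEquiv v).toRingEquiv (algebraMap _ (v.adicCompletion ℚ) r) =
        algebraMap ℤ_[primesEquiv v] ℚ_[primesEquiv v]
          ((adicCompletionIntegers.padicIntEquiv v).toRingEquiv r) := fun r ↦ rfl
  refine (addVal_Δ_minimal_ringEquiv' _ _ hc (W.baseChange (v.adicCompletion ℚ)) ?_).symm
  rw [baseChange, baseChange, map_map]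
  congr 1
  exact Subsingleton.elim _ _

variable [Module.Free ℤ R]

/-- The minimal discriminant norm over any integer ring `R` of `ℚ` (`R = ℤ` or `R = 𝓞 ℚ`) is
`∏_p p ^ ord_p (Δ_min)` with the exponents computed in `ℚ_[p]`; in particular it does not depend
on `R`. Silverman, AEC VIII.8 (Definition of `𝒟_{E/K}`). [folklore] -/
theorem minimalDiscriminantNorm_eq_finprod_primes (W : WeierstrassCurve ℚ) :
    W.minimalDiscriminantNorm R =
      ∏ᶠ p : Nat.Primes, haveI : Fact p.1.Prime := ⟨p.2⟩
        (p : ℕ) ^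
          (addVal ℤ_[p] (((W.baseChange ℚ_[p]).minimal ℤ_[p]).integralModel ℤ_[p]).Δ).toNat := by
  have _inst (p : Nat.Primes) : Fact p.1.Prime := ⟨p.2⟩
  unfold minimalDiscriminantNorm minimalDiscriminantIdeal
  have hcoe : ∀ I, (Ideal.absNorm (S := R)).toMonoidHom I = Ideal.absNorm I := fun _ ↦ rfl
  have h := MonoidHom.map_finprod_of_preimage_one (Ideal.absNorm (S := R)).toMonoidHom
    (fun I hI ↦ by simpa [hcoe, Ideal.one_eq_top] using hI)
    (fun v : HeightOneSpectrum R ↦ v.asIdeal ^ W.ordMinimalDiscriminant v)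
  simp only [hcoe, map_pow] at h
  rw [h]
  simp only [absNorm_asIdeal_eq_natGenerator, ordMinimalDiscriminant_eq_padic]
  exact finprod_comp_equiv primesEquiv
    (f := fun p : Nat.Primes ↦ (p : ℕ) ^
      (addVal ℤ_[p] (((W.baseChange ℚ_[p]).minimal ℤ_[p]).integralModel ℤ_[p]).Δ).toNat)

end Padic

section RatHolds

open NumberField

/-- **Discharge** of the named fact `WeierstrassCurve.minimalDiscriminantNorm_ringOfIntegers_rat`:
`W.minimalDiscriminantNorm (𝓞 ℚ) = W.minimalDiscriminantNorm ℤ` for every `W : WeierstrassCurve ℚ`.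
Both sides equal `∏ᶠ p, p ^ ord_p (Δ_min)` computed in `ℚ_[p]`
(`WeierstrassCurve.minimalDiscriminantNorm_eq_finprod_primes`, applied to `R = 𝓞 ℚ` and `R = ℤ`).
The mathematical input is that `ord_v (Δ_min)` is intrinsic to the valued field
(Silverman, AEC VII.1, Prop. 1.3(b)) and the definition of `𝒟_{E/K}` (AEC VIII.8); the bridge
itself is folklore. [folklore] -/
theorem minimalDiscriminantNorm_ringOfIntegers_rat_holds (W : WeierstrassCurve ℚ) :
    minimalDiscriminantNorm_ringOfIntegers_rat W := by
  unfold minimalDiscriminantNorm_ringOfIntegers_rat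
  rw [minimalDiscriminantNorm_eq_finprod_primes, minimalDiscriminantNorm_eq_finprod_primes]

end RatHolds

end WeierstrassCurve
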